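import Summits.AnomalousDissipation.AnomalousDissipation.Theorems.SolenoidalFractalHomogenisationLagrangianStepVmodDistortedTestPairingClass
import Summits.AnomalousDissipation.AnomalousDissipation.Theorems.SolenoidalFractalHomogenisationLagrangianStepVmodSolenoidalClass
import HarnessLib

/-!
# K1L_D (stmt-AnomalousDissipation-27980), (ℓ3-A) road A: (D-GEN) from a GENERAL BASE TIME `s` — `|⟪U s t y, ψ(t)⟫ − ⟪y, ψ(s)⟫| ≤ (t−s)·N·‖y‖`
(helper; `--supports 27980 --as helper`; prover ad-k1loc-p3 g12; tool (T3-port) of memo `HOME/ad-k1loc-p3/S2-NOTE-p3g12.md` §2: the PIN TRICK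
applies the forward generator bound to the coarse member from the base `s = t₀ − σ`, not from the reset.)

CONVENTION (D28-8′): derivative-index distortion `Torus.Visc4.conj`; constraint `∇·(G v) = 0`.

p722918/p723523 (`…_of_lipschitzTest`, `…_of_gradBound`, `…_frameClass`) state the generator-level bound from the frame RESET `s = 0`, where
`G 0 = 1` makes the datum classes flat (`apply_eq_apply_starProjection_reset`).  From a general base time the datum is seen through the
`G(s)`-SOLENOIDAL CLASS `VmodDist.solClass (G s)` (p725690; closed, with orthogonal projection `P_s`): `U s t y = U s t (P_s y)`
(`eq_zero_of_orth`) and `⟪y, ψ(s)⟫ = ⟪P_s y, ψ(s)⟫` because an admissible test slice `ψ(s)` (`∇·(G(s)ψ(s)) = 0`) lies in the class.  The rest is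
p722918's proof VERBATIM on the SHIFTED data `τ ↦ b (s+τ)`, `τ ↦ G (s+τ)`, `τ ↦ ψ (s+τ)` (the du Bois-Reymond identity
`ae_integral_inner_lipschitzField_eq` is base-free; a.e. hypotheses are shifted by `Torus.ae_restrict_Ioo_comp_add_left`).
* `IsDistortedPropagator.apply_eq_apply_starProjection_solClass`, `inner_eq_inner_starProjection_solClass_of_test`;
* `IsDistortedPropagator.continuousOn_inner_toLp_base` (`t ↦ ⟪U s t y, ψ(t)⟫` continuous on `[s,Tw]`);
* **`IsDistortedPropagator.abs_inner_sub_inner_le_of_lipschitzTest_base`** (frame: `C¹` slices, jointly continuous entries, `|∂_yG| ≤ B` on `[0,Tw]`;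
  `hsol` local) and **`…_frameClass_base`** over `IsFrameModulation` as typed.
`sorry`-free; NOT a proof of any block, of K1L_D or of AD; rung F-D1.A0.
-/

set_option linter.dupNamespace false

noncomputable section

namespace Summit.AnomalousDissipation.AnomalousDissipation.Theorems.SolenoidalFractalHomogenisation.LagrangianStep.CellClauseMod

open Literature.Analysis Literature.Analysis.FluidPDE Literature.Analysis.FunctionSpaces
open MeasureTheory Set Filter UnitAddTorus Function Topology
open scoped ENNReal NNReal InnerProductSpace
open Summit.AnomalousDissipation.AnomalousDissipation.Theorems.SolenoidalFractalHomogenisation.LagrangianStep.VmodDist (solClass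
  mem_solClass_iff hasOrthogonalProjection_solClass)

variable {Tw : ℝ} {𝔸 : Torus.Visc4 (Fin 3)} {b : ℝ → VF} {G : ℝ → UnitAddTorus (Fin 3) → Matrix (Fin 3) (Fin 3) ℝ}
  {U : ℝ → ℝ → (V2 →L[ℝ] V2)}

/-- The `L²` pairing of two `L²` representatives is the inner product of their classes. -/
private theorem integral_inner_eq_inner_toLp₃ {f g : VF} (hf : MemLp f 2 volume) (hg : MemLp g 2 volume) :
    ∫ x, ⟪f x, g x⟫_ℝ = ⟪hf.toLp f, hg.toLp g⟫_ℝ := by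
  rw [L2.inner_def]
  exact integral_congr_ae (by
    filter_upwards [hf.coeFn_toLp, hg.coeFn_toLp] with x hx hy
    rw [hx, hy])

/-- Cauchy–Schwarz for the pairing of an `L²` representative with a field of `L²` norm at most `N`. -/
private theorem abs_integral_inner_le_of_eLpNorm_le₃ {f g : VF} (hf : MemLp f 2 volume) (hg : MemLp g 2 volume)
    {N : ℝ} (hN0 : 0 ≤ N) (hN : eLpNorm g 2 volume ≤ ENNReal.ofReal N) :
    |∫ x, ⟪f x, g x⟫_ℝ| ≤ ‖hf.toLp f‖ * N := by
  rw [integral_inner_eq_inner_toLp₃ hf hg]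
  refine (abs_real_inner_le_norm _ _).trans (mul_le_mul_of_nonneg_left ?_ (norm_nonneg _))
  rw [Lp.norm_toLp]
  exact ENNReal.toReal_le_of_le_ofReal hN0 hN

/-! ## §1 The datum through the `G(s)`-solenoidal class -/

/-- **A distorted propagator sees only the `G(s)`-solenoidal projection of its datum**: `U s t y = U s t (P_s y)`, `P_s` the orthogonal projection
onto `solClass (G s)` (frame slice with continuous entries). -/
theorem IsDistortedPropagator.apply_eq_apply_starProjection_solClass (hU : IsDistortedPropagator Tw 𝔸 b G U) {s : ℝ}
    (hGs : ∀ a c, Continuous fun y => G s y a c) (t : ℝ) (y : V2) :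
    haveI := hasOrthogonalProjection_solClass (G s)
    U s t y = U s t ((solClass (G s)).starProjection y) := by
  haveI := hasOrthogonalProjection_solClass (G s)
  set P := (solClass (G s)).starProjection with hP
  have h0 : U s t (y - P y) = 0 := hU.eq_zero_of_orth s t (y - P y) fun z hz =>
    (solClass (G s)).starProjection_inner_eq_zero y z ((mem_solClass_iff hGs z).2 hz)
  have h1 : U s t y - U s t (P y) = 0 := by rw [← map_sub, h0]
  exact sub_eq_zero.1 h1

/-- `distort` respects a.e. equality of the field. -/
theorem distort_congr_ae {Gs : UnitAddTorus (Fin 3) → Matrix (Fin 3) (Fin 3) ℝ} {f g : VF} (h : f =ᵐ[volume] g) :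
    Torus.distort Gs f =ᵐ[volume] Torus.distort Gs g := by
  filter_upwards [h] with y hy
  ext c
  rw [Torus.distort_apply, Torus.distort_apply, hy]

/-- The `L²` class of an admissible test slice lies in the `G(s)`-solenoidal class. -/
theorem toLp_mem_solClass_of_isDivFree_distort {Gs : UnitAddTorus (Fin 3) → Matrix (Fin 3) (Fin 3) ℝ} (hGs : ∀ a c, Torus.IsSmooth fun y => Gs y a c)
    {ψs : VF} (hψs : Torus.IsSmooth ψs) (hdiv : Torus.IsDivFree (Torus.distort Gs ψs)) :
    (hψs.memLp 2).toLp ψs ∈ solClass Gs := by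
  refine (mem_solClass_iff (fun a c => (hGs a c).continuous) _).2 ?_
  have h1 : Torus.IsWeaklyDivFree (Torus.distort Gs ψs) := hdiv.isWeaklyDivFree_holds (Torus.isSmooth_distort hGs hψs)
  exact h1.congr_ae (distort_congr_ae (MemLp.coeFn_toLp _).symm)

/-- **The datum pairs with an admissible test slice through its projection**: `⟪y, ψ(s)⟫ = ⟪P_s y, ψ(s)⟫`. -/
theorem inner_eq_inner_starProjection_solClass_of_test {Gs : UnitAddTorus (Fin 3) → Matrix (Fin 3) (Fin 3) ℝ}
    (hGs : ∀ a c, Torus.IsSmooth fun y => Gs y a c) {ψs : VF} (hψs : Torus.IsSmooth ψs) (hdiv : Torus.IsDivFree (Torus.distort Gs ψs)) (y : V2) :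
    haveI := hasOrthogonalProjection_solClass Gs
    ⟪y, (hψs.memLp 2).toLp ψs⟫_ℝ = ⟪(solClass Gs).starProjection y, (hψs.memLp 2).toLp ψs⟫_ℝ := by
  haveI := hasOrthogonalProjection_solClass Gs
  have h0 : ⟪y - (solClass Gs).starProjection y, (hψs.memLp 2).toLp ψs⟫_ℝ = 0 :=
    (solClass Gs).starProjection_inner_eq_zero y _ (toLp_mem_solClass_of_isDivFree_distort hGs hψs hdiv)
  rw [inner_sub_left] at h0
  linarith

/-! ## §2 Continuity of the tested orbit from a base time -/

/-- **Continuity of the tested orbit from the base `s`**: `t ↦ ⟪U s t y, ψ(t)⟫` is continuous on `[s,Tw]`. -/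
theorem IsDistortedPropagator.continuousOn_inner_toLp_base (hU : IsDistortedPropagator Tw 𝔸 b G U) {s : ℝ} (hs : 0 ≤ s) (hsT : s ≤ Tw)
    {ψ : ℝ → VF} (hψs : ∀ t, Torus.IsSmooth (ψ t))
    (hψL : ∃ L : ℝ, 0 ≤ L ∧ ∀ t ∈ Icc 0 Tw, ∀ s ∈ Icc 0 Tw, ∀ y, ‖ψ t y - ψ s y‖ ≤ L * |t - s|) (y : V2) :
    ContinuousOn (fun t => ⟪U s t y, ((hψs t).memLp 2).toLp (ψ t)⟫_ℝ) (Icc s Tw) := by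
  obtain ⟨L, hL0, hL⟩ := hψL
  set Ψ : ℝ → V2 := fun t => ((hψs t).memLp 2).toLp (ψ t) with hΨ
  intro t₀ ht₀
  have ht₀' : t₀ ∈ Icc 0 Tw := ⟨hs.trans ht₀.1, ht₀.2⟩
  have hsplit : ∀ t, ⟪U s t y, Ψ t⟫_ℝ = ⟪U s t y, Ψ t - Ψ t₀⟫_ℝ + ⟪U s t y, Ψ t₀⟫_ℝ := fun t => by
    rw [inner_sub_right]; ring
  have e : (fun t => ⟪U s t y, ((hψs t).memLp 2).toLp (ψ t)⟫_ℝ) = fun t => ⟪U s t y, Ψ t - Ψ t₀⟫_ℝ + ⟪U s t y, Ψ t₀⟫_ℝ :=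
    funext hsplit
  rw [ContinuousWithinAt, e]
  rw [show ⟪U s t₀ y, ((hψs t₀).memLp 2).toLp (ψ t₀)⟫_ℝ = 0 + ⟪U s t₀ y, Ψ t₀⟫_ℝ by rw [zero_add]]
  refine Filter.Tendsto.add ?_ (hU.continuousOn s hs hsT y (Ψ t₀) t₀ ht₀)
  have hbd : ∀ t ∈ Icc s Tw, |⟪U s t y, Ψ t - Ψ t₀⟫_ℝ| ≤ ‖y‖ * (L * |t - t₀|) := fun t ht =>
    (abs_real_inner_le_norm _ _).trans (mul_le_mul (hU.norm_le s t y)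
      (norm_toLp_sub_toLp_le hψs hL0 hL ⟨hs.trans ht.1, ht.2⟩ ht₀') (norm_nonneg _) (norm_nonneg _))
  have hg : Tendsto (fun t => ‖y‖ * (L * |t - t₀|)) (𝓝[Icc s Tw] t₀) (𝓝 0) := by
    have hc : Continuous fun t : ℝ => ‖y‖ * (L * |t - t₀|) := by fun_prop
    have h0 : ‖y‖ * (L * |t₀ - t₀|) = 0 := by simp
    rw [← h0]
    exact (hc.tendsto t₀).mono_left nhdsWithin_le_nhds
  refine squeeze_zero_norm' ?_ hg
  filter_upwards [self_mem_nhdsWithin] with t ht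
  rw [Real.norm_eq_abs]; exact hbd t ht

/-! ## §3 (D-GEN) from the base time `s` -/

set_option maxHeartbeats 1600000 in
/-- **(D-GEN) FROM A GENERAL BASE TIME.**  For a distorted propagator, the existence clause `hsol`, a frame with `C¹` slices, jointly continuous
entries and `|∂_yG| ≤ B` on `[0,Tw]`, an admissible field `ψ` on `[0,Tw]` (smooth slices, iterated derivatives jointly continuous, time-Lipschitz,
`∇·(G(t)ψ(t)) = 0`, a.e. time derivative `ψ'`) and `N ≥ ‖ψ' + (b·∇)ψ + 𝓛^{G,*}_𝔸 ψ‖_{L²}` a.e. on `(0,Tw)`: for `0 ≤ s < Tw`, every `t ∈ [s,Tw]`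
and every `y ∈ V2`,  `|⟪U s t y, ψ(t)⟫ − ⟪y, ψ(s)⟫| ≤ (t − s) · N · ‖y‖`.
[cite: DiPernaLions1989, §II.1 (12)–(14)] [cite: Temam1997, Ch. II §3.1–3.2, (3.2)–(3.5), Thm. 3.1] -/
theorem IsDistortedPropagator.abs_inner_sub_inner_le_of_lipschitzTest_base (hU : IsDistortedPropagator Tw 𝔸 b G U)
    (hsol : ∀ s, 0 ≤ s → s < Tw → ∀ (φ : VF) (hφ : MemLp φ 2 volume), Torus.IsWeaklyDivFree (Torus.distort (G s) φ) → ∃ w : ℝ → VF,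
      Torus.IsWeakTensorPassiveVectorDistortedOn 0 (Tw - s) 𝔸 (fun τ => b (s + τ)) (fun τ => G (s + τ)) φ w)
    (hG1 : ∀ t i j, Torus.IsContDiff 1 (fun y => G t y i j))
    (hGsm : ∀ t i j, Torus.IsSmooth (fun y => G t y i j))
    (hGc : ∀ i j, Continuous (uncurry fun t y => G t y i j))
    {B : ℝ} (hGb : ∀ t ∈ Icc 0 Tw, ∀ y i j e', |Torus.partialDeriv e' (fun y => G t y i j) y| ≤ B)
    {ψ ψ' : ℝ → VF} (hψs : ∀ t, Torus.IsSmooth (ψ t))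
    (hψc : ∀ l : List (Fin 3), Continuous (uncurry fun t y => Torus.iterPartialDeriv l (ψ t) y))
    (hψL : ∃ L : ℝ, 0 ≤ L ∧ ∀ t ∈ Icc 0 Tw, ∀ s ∈ Icc 0 Tw, ∀ y, ‖ψ t y - ψ s y‖ ≤ L * |t - s|)
    (hψdiv : ∀ t, Torus.IsDivFree (Torus.distort (G t) (ψ t)))
    (hψ' : ∀ᵐ t ∂(volume.restrict (Ioo 0 Tw)), ∀ y, HasDerivAt (fun s => ψ s y) (ψ' t y) t)
    {N : ℝ} (hN0 : 0 ≤ N)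
    (hN : ∀ᵐ τ ∂(volume.restrict (Ioo 0 Tw)),
      MemLp (fun x => ψ' τ x + Torus.convect (b τ) (ψ τ) x + Torus.viscAdjVar (fun y => Torus.Visc4.conj (G τ y) 𝔸) (ψ τ) x) 2 volume ∧
      eLpNorm (fun x => ψ' τ x + Torus.convect (b τ) (ψ τ) x + Torus.viscAdjVar (fun y => Torus.Visc4.conj (G τ y) 𝔸) (ψ τ) x) 2 volume
        ≤ ENNReal.ofReal N)
    {s : ℝ} (hs : 0 ≤ s) (hsT : s < Tw) {t : ℝ} (ht : t ∈ Icc s Tw) (y : V2) :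
    |⟪U s t y, ((hψs t).memLp 2).toLp (ψ t)⟫_ℝ - ⟪y, ((hψs s).memLp 2).toLp (ψ s)⟫_ℝ| ≤ (t - s) * N * ‖y‖ := by
  haveI := hasOrthogonalProjection_solClass (G s)
  set Ψ : ℝ → V2 := fun t => ((hψs t).memLp 2).toLp (ψ t) with hΨdef
  -- only the `G(s)`-solenoidal projection of `y` is seen on both sides
  set P := (solClass (G s)).starProjection with hPdef
  set y' := P y with hy'def
  have hGs_cont : ∀ a c, Continuous fun z => G s z a c := fun a c => (hGsm s a c).continuous
  have hy'w : Torus.IsWeaklyDivFree (Torus.distort (G s) ((y' : V2) : VF)) :=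
    (mem_solClass_iff hGs_cont _).1 ((solClass (G s)).starProjection_apply_mem y)
  have hUy : U s t y = U s t y' := hU.apply_eq_apply_starProjection_solClass hGs_cont t y
  have hyΨ : ⟪y, Ψ s⟫_ℝ = ⟪y', Ψ s⟫_ℝ := inner_eq_inner_starProjection_solClass_of_test (hGsm s) (hψs s) (hψdiv s) y
  have hny : ‖y'‖ ≤ ‖y‖ := (solClass (G s)).norm_starProjection_apply_le y
  show |⟪U s t y, Ψ t⟫_ℝ - ⟪y, Ψ s⟫_ℝ| ≤ (t - s) * N * ‖y‖
  rw [hUy, hyΨ]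
  refine le_trans ?_ (mul_le_mul_of_nonneg_left hny (mul_nonneg (by linarith [ht.1]) hN0))
  have hL : 0 < Tw - s := sub_pos.2 hsT
  -- ONE distorted weak solution from `y'` on `[0, Tw − s)` (relative clock), represented by `U s (s + ·)`
  set φ : VF := ((y' : V2) : VF) with hφdef
  have hφ : MemLp φ 2 volume := Lp.memLp y'
  have hyφ : hφ.toLp φ = y' := Lp.toLp_coeFn y' hφ
  obtain ⟨w, hw⟩ := hsol s hs hsT φ hφ hy'w
  have hrep : ∀ᵐ τ ∂(volume.restrict (Ioo 0 (Tw - s))), ∃ hτ : MemLp (w τ) 2 volume, hτ.toLp (w τ) = U s (s + τ) (hφ.toLp φ) :=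
    hU.repr s hs hsT φ hφ hy'w w hw
  -- the SHIFTED admissible field `τ ↦ ψ (s + τ)` on `[0, Tw − s]`
  set ψt : ℝ → VF := fun τ => ψ (s + τ) with hψtdef
  have hψts : ∀ τ, Torus.IsSmooth (ψt τ) := fun τ => hψs (s + τ)
  have hshift : Continuous fun p : ℝ × UnitAddTorus (Fin 3) => (s + p.1, p.2) := (continuous_const.add continuous_fst).prodMk continuous_snd
  have hψtc : ∀ l : List (Fin 3), Continuous (uncurry fun τ y => Torus.iterPartialDeriv l (ψt τ) y) := fun l => (hψc l).comp hshift
  have hψtL : ∃ L : ℝ, 0 ≤ L ∧ ∀ t ∈ Icc 0 (Tw - s), ∀ r ∈ Icc 0 (Tw - s), ∀ y, ‖ψt t y - ψt r y‖ ≤ L * |t - r| := by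
    obtain ⟨L, hL0, hLip⟩ := hψL
    refine ⟨L, hL0, fun t ht r hr y => ?_⟩
    have h := hLip (s + t) ⟨by linarith [ht.1], by linarith [ht.2]⟩ (s + r) ⟨by linarith [hr.1], by linarith [hr.2]⟩ y
    rwa [show s + t - (s + r) = t - r by ring] at h
  have hψtdiv : ∀ τ, Torus.IsDivFree (Torus.distort (G (s + τ)) (ψt τ)) := fun τ => hψdiv (s + τ)
  have hψt' : ∀ᵐ τ ∂(volume.restrict (Ioo 0 (Tw - s))), ∀ y, HasDerivAt (fun r => ψt r y) (ψ' (s + τ) y) τ := by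
    have h := Torus.ae_restrict_Ioo_comp_add_left (T' := Tw - s) (P := fun t => ∀ y, HasDerivAt (fun r => ψ r y) (ψ' t y) t) hψ' hs
      (by linarith)
    filter_upwards [h] with τ hτ y
    exact (hτ y).comp_const_add s τ
  have hψt'' : ∀ᵐ τ ∂(volume.restrict (Ioo 0 (Tw - s))), ∀ x, HasDerivAt (fun r => ψt r x) (Torus.timeDeriv ψt τ x) τ := by
    filter_upwards [hψt'] with τ hτ x
    have e : Torus.timeDeriv ψt τ x = ψ' (s + τ) x := (hτ x).deriv
    rw [e]; exact hτ x
  -- the shifted frame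
  have hGt1 : ∀ τ i j, Torus.IsContDiff 1 (fun y => G (s + τ) y i j) := fun τ i j => hG1 (s + τ) i j
  have hGtc : ∀ i j, Continuous (uncurry fun τ y => G (s + τ) y i j) := fun i j => (hGc i j).comp hshift
  have hGtb : ∀ τ ∈ Icc 0 (Tw - s), ∀ y i j e', |Torus.partialDeriv e' (fun y => G (s + τ) y i j) y| ≤ B :=
    fun τ hτ y i j e' => hGb (s + τ) ⟨by linarith [hτ.1], by linarith [hτ.2]⟩ y i j e'
  have hint := integrable_weakIntegrand_lipschitzField_of_gradBound hw hψts hψtc hψtL hGt1 hGtc hGtb 𝔸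
  have hid := hw.ae_integral_inner_lipschitzField_eq hψts hψtc hψtL hψtdiv hψt'' hint
  -- the shifted generator bound
  have hNt : ∀ᵐ τ ∂(volume.restrict (Ioo 0 (Tw - s))),
      MemLp (fun x => ψ' (s + τ) x + Torus.convect (b (s + τ)) (ψt τ) x +
          Torus.viscAdjVar (fun y => Torus.Visc4.conj (G (s + τ) y) 𝔸) (ψt τ) x) 2 volume ∧
      eLpNorm (fun x => ψ' (s + τ) x + Torus.convect (b (s + τ)) (ψt τ) x +
          Torus.viscAdjVar (fun y => Torus.Visc4.conj (G (s + τ) y) 𝔸) (ψt τ) x) 2 volume ≤ ENNReal.ofReal N :=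
    Torus.ae_restrict_Ioo_comp_add_left (P := fun τ =>
      MemLp (fun x => ψ' τ x + Torus.convect (b τ) (ψ τ) x + Torus.viscAdjVar (fun y => Torus.Visc4.conj (G τ y) 𝔸) (ψ τ) x) 2 volume ∧
      eLpNorm (fun x => ψ' τ x + Torus.convect (b τ) (ψ τ) x + Torus.viscAdjVar (fun y => Torus.Visc4.conj (G τ y) 𝔸) (ψ τ) x) 2 volume
        ≤ ENNReal.ofReal N) (T' := Tw - s) hN hs (by linarith)
  -- the bound on the integrand, a.e. in relative time
  set Φ : ℝ → ℝ := fun σ =>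
    ∫ x, (⟪w σ x, Torus.timeDeriv ψt σ x + Torus.convect (b (s + σ)) (ψt σ) x +
        Torus.viscAdjVar (fun y => Torus.Visc4.conj (G (s + σ) y) 𝔸) (ψt σ) x⟫_ℝ +
      0 * ⟪b (s + σ) x, Torus.convect (w σ) (ψt σ) x⟫_ℝ) with hΦdef
  have hΦle : ∀ᵐ σ ∂(volume.restrict (Ioo 0 (Tw - s))), ‖Φ σ‖ ≤ N * ‖y'‖ := by
    filter_upwards [hrep, hNt, hψt'] with σ hσ hNσ hdσ
    obtain ⟨hm, he⟩ := hσ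
    have hd' : ∀ x, Torus.timeDeriv ψt σ x = ψ' (s + σ) x := fun x => by simp only [Torus.timeDeriv, (hdσ x).deriv]
    rw [hΦdef]
    simp only [zero_mul, add_zero, hd']
    rw [Real.norm_eq_abs]
    have h1 := abs_integral_inner_le_of_eLpNorm_le₃ hm hNσ.1 hN0 hNσ.2
    rw [he, hyφ] at h1
    calc |∫ x, ⟪w σ x, ψ' (s + σ) x + Torus.convect (b (s + σ)) (ψt σ) x +
            Torus.viscAdjVar (fun y => Torus.Visc4.conj (G (s + σ) y) 𝔸) (ψt σ) x⟫_ℝ|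
        ≤ ‖U s (s + σ) y'‖ * N := h1
      _ ≤ ‖y'‖ * N := mul_le_mul_of_nonneg_right (hU.norm_le _ _ _) hN0
      _ = N * ‖y'‖ := mul_comm _ _
  -- a.e. relative time `τ ∈ (0, Tw − s)`: the bound at `s + τ`
  have hae : ∀ᵐ τ ∂(volume.restrict (Ioo 0 (Tw - s))), |⟪U s (s + τ) y', Ψ (s + τ)⟫_ℝ - ⟪y', Ψ s⟫_ℝ| ≤ τ * N * ‖y'‖ := by
    filter_upwards [hrep, hid, ae_restrict_mem measurableSet_Ioo] with τ hτr hτi hτm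
    obtain ⟨hm, he⟩ := hτr
    have e1 : ⟪U s (s + τ) y', Ψ (s + τ)⟫_ℝ = ∫ x, ⟪w τ x, ψt τ x⟫_ℝ := by
      rw [hΨdef, integral_inner_eq_inner_toLp₃ hm ((hψs (s + τ)).memLp 2), he, hyφ]
    have e2 : ⟪y', Ψ s⟫_ℝ = ∫ x, ⟪φ x, ψt 0 x⟫_ℝ := by
      have e0 : ψt 0 = ψ s := by simp [hψtdef]
      rw [hΨdef, integral_inner_eq_inner_toLp₃ hφ ((hψts 0).memLp 2), hyφ]
      congr 1
      exact (MemLp.toLp_eq_toLp_iff _ _).2 (by rw [e0])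
    rw [e1, e2, hτi, add_sub_cancel_left]
    have hΦτ : ∀ᵐ σ ∂(volume.restrict (Ioc 0 τ)), ‖Φ σ‖ ≤ N * ‖y'‖ := by
      rw [← Measure.restrict_congr_set Ioo_ae_eq_Ioc]
      exact ae_restrict_of_ae_restrict_of_subset (Ioo_subset_Ioo le_rfl hτm.2.le) hΦle
    have key := norm_setIntegral_le_of_norm_le_const_ae (measure_Ioc_lt_top (a := (0:ℝ)) (b := τ)) hΦτ
    rw [Real.norm_eq_abs, Measure.real, Real.volume_Ioc, sub_zero, ENNReal.toReal_ofReal hτm.1.le] at key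
    calc |∫ σ in Ioc 0 τ, Φ σ| ≤ N * ‖y'‖ * τ := key
      _ = τ * N * ‖y'‖ := by ring
  -- every relative time by continuity
  have hcont := hU.continuousOn_inner_toLp_base hs hsT.le hψs hψL y'
  have hf : ContinuousOn (fun τ => |⟪U s (s + τ) y', Ψ (s + τ)⟫_ℝ - ⟪y', Ψ s⟫_ℝ|) (Icc 0 (Tw - s)) := by
    have hmap : MapsTo (fun τ : ℝ => s + τ) (Icc 0 (Tw - s)) (Icc s Tw) := fun τ hτ => ⟨by linarith [hτ.1], by linarith [hτ.2]⟩
    exact ((hcont.comp (continuous_const.add continuous_id).continuousOn hmap).sub continuousOn_const).abs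
  have hg : ContinuousOn (fun τ => τ * N * ‖y'‖) (Icc 0 (Tw - s)) := ((continuous_id.mul continuous_const).mul continuous_const).continuousOn
  have key := Torus.le_on_Icc_of_ae_le_of_continuousOn₂ hL hf hg hae (t - s) ⟨by linarith [ht.1], by linarith [ht.2]⟩
  simpa only [show s + (t - s) = t by ring] using key

/-- **(D-GEN) from a general base time OVER THE CLASS OF RECORD** `IsFrameModulation θ Tw nC G` (frame regularity from the class; `hsol` local). -/
theorem IsDistortedPropagator.abs_inner_sub_inner_le_of_lipschitzTest_frameClass_base {θ nC : ℝ} (hU : IsDistortedPropagator Tw 𝔸 b G U)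
    (hG : IsFrameModulation θ Tw nC G)
    (hsol : ∀ s, 0 ≤ s → s < Tw → ∀ (φ : VF) (hφ : MemLp φ 2 volume), Torus.IsWeaklyDivFree (Torus.distort (G s) φ) → ∃ w : ℝ → VF,
      Torus.IsWeakTensorPassiveVectorDistortedOn 0 (Tw - s) 𝔸 (fun τ => b (s + τ)) (fun τ => G (s + τ)) φ w)
    {ψ ψ' : ℝ → VF} (hψs : ∀ t, Torus.IsSmooth (ψ t))
    (hψc : ∀ l : List (Fin 3), Continuous (uncurry fun t y => Torus.iterPartialDeriv l (ψ t) y))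
    (hψL : ∃ L : ℝ, 0 ≤ L ∧ ∀ t ∈ Icc 0 Tw, ∀ s ∈ Icc 0 Tw, ∀ y, ‖ψ t y - ψ s y‖ ≤ L * |t - s|)
    (hψdiv : ∀ t, Torus.IsDivFree (Torus.distort (G t) (ψ t)))
    (hψ' : ∀ᵐ t ∂(volume.restrict (Ioo 0 Tw)), ∀ y, HasDerivAt (fun s => ψ s y) (ψ' t y) t)
    {N : ℝ} (hN0 : 0 ≤ N)
    (hN : ∀ᵐ τ ∂(volume.restrict (Ioo 0 Tw)),
      MemLp (fun x => ψ' τ x + Torus.convect (b τ) (ψ τ) x + Torus.viscAdjVar (fun y => Torus.Visc4.conj (G τ y) 𝔸) (ψ τ) x) 2 volume ∧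
      eLpNorm (fun x => ψ' τ x + Torus.convect (b τ) (ψ τ) x + Torus.viscAdjVar (fun y => Torus.Visc4.conj (G τ y) 𝔸) (ψ τ) x) 2 volume
        ≤ ENNReal.ofReal N)
    {s : ℝ} (hs : 0 ≤ s) (hsT : s < Tw) {t : ℝ} (ht : t ∈ Icc s Tw) (y : V2) :
    |⟪U s t y, ((hψs t).memLp 2).toLp (ψ t)⟫_ℝ - ⟪y, ((hψs s).memLp 2).toLp (ψ s)⟫_ℝ| ≤ (t - s) * N * ‖y‖ :=
  have hTw : 0 ≤ Tw := hs.trans hsT.le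
  hU.abs_inner_sub_inner_le_of_lipschitzTest_base hsol (fun t i j => hG.isContDiff_one_entry hTw t i j) (fun t i j => hG.smooth_all hTw t i j)
    (fun i j => hG.continuous_uncurry_entry hTw i j) (fun t ht' y i j e' => hG.grad_le t ht' y i j e') hψs hψc hψL hψdiv hψ' hN0 hN hs hsT ht y

end Summit.AnomalousDissipation.AnomalousDissipation.Theorems.SolenoidalFractalHomogenisation.LagrangianStep.CellClauseMod

end
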